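import Literature.NumberTheory.EllipticCurves.CasselsTateParity
import HarnessLib

/-!
# The `ℤ_p`-corank of a stable `p`-primary group

Topic `Literature/NumberTheory/EllipticCurves`, family `bsd`. Pure group theory around the tree's
corank formula `Literature.NumberTheory.EllipticCurves.zpCorank A p = dim_{𝔽_p} A[p] - dim_{𝔽_p} A/pA`
(Greenberg, LNM 1716, §1: the `ℤ_p`-corank of a cofinitely generated `p`-primary group
`A ≅ (ℚ_p/ℤ_p)^ρ ⊕ F`, `F` finite, is `ρ`).

* `pow_zpCorank_eq_natCard_torsionBy_inf_range_of_stable`: let `A` be a `p`-primary abelian group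
  with finite `A[p]`, and let `k` be a stability index of the decreasing chain `A[p] ∩ p^{k'} A`
  of subgroups of `A[p]` (such a `k` exists, `exists_torsionBy_inf_range_stable`). Then
  **`p ^ zpCorank A p = #(A[p] ∩ p^k A)`**: the corank is the `𝔽_p`-dimension of the `p`-torsion
  of the divisible part `p^k A = ⋂ p^{k'} A` of `A`. Classically both sides are `p^ρ`; as in
  `CasselsTateParity` the structure theorem is avoided: `C = p^k A` is `p`-divisible
  (`exists_nsmul_eq_of_stable`), so along `0 → C → A → T = A/C → 0` one has
  `#A[p] = #T[p] · #C[p]` (`natCard_torsionBy_eq_mul`) and `A/pA ≃ T/pT` (`modNEquivOfExact`);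
  `T` is finite (`T[p]` is the image of `A[p]`, and `p^k T = 0`), so `#T/pT = #T[p]`
  (`Literature.GroupTheory.FiniteAbelian.natCard_torsionBy_eq_natCard_modN`); and `C[p] = A[p] ∩ C`.
  Hence `p ^ dim A[p] = p ^ dim A/pA · #(A[p] ∩ C)`.

This is the input "corank = dimension of the `p`-torsion of the divisible part" of the `p`-primary
reduction of Cassels' isogeny-pair parity formula.

## References

* R. Greenberg, *Iwasawa theory for elliptic curves*, in: Arithmetic theory of elliptic curves
  (Cetraro 1997), Lecture Notes in Math. 1716, Springer (1999), 51–144, §1 (the corank of a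
  cofinitely generated `p`-primary group). Otherwise [folklore].
-/

noncomputable section

open scoped AddSubgroup

namespace Literature.NumberTheory.EllipticCurves

universe u

/-- **The `ℤ_p`-corank of a stable `p`-primary group.** For a `p`-primary abelian group `A` with
finite `A[p]` and a stability index `k` of the chain `A[p] ∩ p^{k'} A` (`k ≤ k'`),
`p ^ zpCorank A p = #(A[p] ∩ p^k A)`. Proof: `C = p^k A` is `p`-divisible
(`exists_nsmul_eq_of_stable`); along `0 → C → A → A/C → 0`, `#A[p] = #(A/C)[p] · #C[p]`
(`natCard_torsionBy_eq_mul`), `A/pA ≃ (A/C)/p(A/C)` (`modNEquivOfExact`), `A/C` is finite so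
`#(A/C)/p = #(A/C)[p]`, and `C[p] = A[p] ∩ C`; finally `zpCorank A p = dim A[p] - dim A/pA`.
Greenberg, LNM 1716, §1 (corank of `(ℚ_p/ℤ_p)^ρ ⊕ F`). [folklore] -/
theorem pow_zpCorank_eq_natCard_torsionBy_inf_range_of_stable
    {A : Type u} [AddCommGroup A] (p : ℕ) [Fact p.Prime]
    (hA : ∀ a : A, ∃ n : ℕ, p ^ n • a = 0) [Finite A[(p : ℤ)]] {k : ℕ}
    (hst : ∀ k', k ≤ k' → A[(p : ℤ)] ⊓ (nsmulAddMonoidHom (α := A) (p ^ k')).range =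
      A[(p : ℤ)] ⊓ (nsmulAddMonoidHom (α := A) (p ^ k)).range) :
    p ^ zpCorank A p = Nat.card ↥(A[(p : ℤ)] ⊓ (nsmulAddMonoidHom (α := A) (p ^ k)).range) := by
  have hp : p.Prime := Fact.out
  set C : AddSubgroup A := (nsmulAddMonoidHom (α := A) (p ^ k)).range with hC
  -- `C` is `p`-divisible
  have hdiv : ∀ c ∈ C, ∃ c' ∈ C, p • c' = c := fun c hc ↦ by
    obtain ⟨n, hn⟩ := hA c
    exact exists_nsmul_eq_of_stable p hst n c hc hn
  have hD : ∀ d : C, ∃ d' : C, p • d' = d := fun d ↦ by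
    obtain ⟨d', hd', h⟩ := hdiv d d.2
    exact ⟨⟨d', hd'⟩, Subtype.ext h⟩
  -- the exact sequence `0 → C → A → A/C → 0`
  have hi : Function.Injective C.subtype := C.subtype_injective
  have hf : Function.Surjective (QuotientAddGroup.mk' C) := QuotientAddGroup.mk'_surjective C
  have hex : ∀ a, QuotientAddGroup.mk' C a = 0 → a ∈ C.subtype.range := fun a ha ↦ by
    rw [AddSubgroup.range_subtype]; exact (QuotientAddGroup.eq_zero_iff a).mp ha
  have hfi : ∀ d : C, QuotientAddGroup.mk' C (C.subtype d) = 0 := fun d ↦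
    (QuotientAddGroup.eq_zero_iff _).mpr d.2
  -- `T = A/C` is finite: `T[p]` is the image of `A[p]`, and `p^k T = 0`
  haveI : Finite (A ⧸ C)[(p : ℤ)] :=
    Finite.of_surjective _ (torsionByMap_surjective (p := p) hf hex hfi hD)
  haveI : Finite (A ⧸ C) := by
    haveI := finite_torsionBy_pow (A ⧸ C) p k
    refine Finite.of_injective (fun z : A ⧸ C ↦ (⟨z, ?_⟩ : (A ⧸ C)[((p ^ k : ℕ) : ℤ)]))
      (fun z w h ↦ congrArg Subtype.val h)
    induction z using QuotientAddGroup.induction_on with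
    | H a =>
      rw [AddSubgroup.torsionBy.nsmul_iff, ← QuotientAddGroup.mk_nsmul, QuotientAddGroup.eq_zero_iff]
      exact ⟨a, rfl⟩
  haveI : Finite ↥(A[(p : ℤ)] ⊓ C) :=
    Finite.of_injective (AddSubgroup.inclusion (inf_le_left : A[(p : ℤ)] ⊓ C ≤ A[(p : ℤ)]))
      (AddSubgroup.inclusion_injective _)
  -- cardinalities
  have h1 : Nat.card A[(p : ℤ)] = Nat.card (A ⧸ C)[(p : ℤ)] * Nat.card C[(p : ℤ)] :=
    natCard_torsionBy_eq_mul (p := p) hi hf hex hfi hD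
  have e : ModN A p ≃+ ModN (A ⧸ C) p := modNEquivOfExact (p := p) hf hex hD
  haveI : Finite (ModN (A ⧸ C) p) := Literature.GroupTheory.FiniteAbelian.finite_modN p
  haveI : Finite (ModN A p) := Finite.of_equiv _ e.symm.toEquiv
  have h2 : Nat.card (ModN A p) = Nat.card (A ⧸ C)[(p : ℤ)] := by
    rw [Nat.card_congr e.toEquiv,
      ← Literature.GroupTheory.FiniteAbelian.natCard_torsionBy_eq_natCard_modN]
  have h3 : Nat.card C[(p : ℤ)] = Nat.card ↥(A[(p : ℤ)] ⊓ C) := by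
    refine Nat.card_congr (Equiv.ofBijective
      (fun x : C[(p : ℤ)] ↦ (⟨((x : C) : A), AddSubgroup.mem_inf.mpr ⟨?_, (x : C).2⟩⟩ :
        ↥(A[(p : ℤ)] ⊓ C))) ⟨?_, ?_⟩)
    · rw [AddSubgroup.torsionBy.nsmul_iff, ← AddSubgroupClass.coe_nsmul,
        AddSubgroup.torsionBy.nsmul_iff.mp (x : C[(p : ℤ)]).2, ZeroMemClass.coe_zero]
    · intro x y hxy
      have h := congrArg Subtype.val hxy
      exact Subtype.ext (Subtype.ext h)
    · rintro ⟨a, ha⟩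
      obtain ⟨ha₁, ha₂⟩ := AddSubgroup.mem_inf.mp ha
      refine ⟨⟨⟨a, ha₂⟩, AddSubgroup.torsionBy.nsmul_iff.mpr (Subtype.ext ?_)⟩, rfl⟩
      rw [AddSubgroupClass.coe_nsmul, ZeroMemClass.coe_zero]
      exact AddSubgroup.torsionBy.nsmul_iff.mp ha₁
  -- dimensions
  letI : Module (ZMod p) A[(p : ℤ)] := AddSubgroup.torsionBy.zmodModule
  have ha : p ^ Module.finrank (ZMod p) A[(p : ℤ)] = Nat.card A[(p : ℤ)] :=
    pow_finrank_eq_natCard _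
  have hb : p ^ Module.finrank (ZMod p) (ModN A p) = Nat.card (ModN A p) :=
    pow_finrank_eq_natCard _
  have hab : p ^ Module.finrank (ZMod p) A[(p : ℤ)] =
      p ^ Module.finrank (ZMod p) (ModN A p) * Nat.card ↥(A[(p : ℤ)] ⊓ C) := by
    rw [ha, hb, h1, h2, h3]
  have hpos : 0 < Nat.card ↥(A[(p : ℤ)] ⊓ C) := Nat.card_pos
  have hle : Module.finrank (ZMod p) (ModN A p) ≤ Module.finrank (ZMod p) A[(p : ℤ)] := by
    rw [← Nat.pow_le_pow_iff_right hp.one_lt, hab]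
    exact Nat.le_mul_of_pos_right _ hpos
  unfold zpCorank
  refine Nat.eq_of_mul_eq_mul_right (pow_pos hp.pos (Module.finrank (ZMod p) (ModN A p))) ?_
  rw [← pow_add, Nat.sub_add_cancel hle, hab, mul_comm]

end Literature.NumberTheory.EllipticCurves

end
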